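import Literature.NumberTheory.EllipticCurves.HeegnerPointsKolyvaginConjugation
import Literature.NumberTheory.EllipticCurves.WeilPairingProofs
import HarnessLib

/-!
# T1 JET (cell `bsd-jet`), road K: the `τ`-EQUIVARIANT WEIL DATUM on `E[n]/K` for a curve over `ℚ`
# — the inputs `e, hμ, hadd₁, hadd₂, hgal, halt, hnondeg, hτe` of the H63 line are a THEOREM

HONEST FRAMING (programme file §HONESTY, verbatim): «no tranche here proves BSD; ARM L moves the
LITERAL column of an r ≤ 1 census into the kernel-proved-modulo-named-print column.» THEOREMS ONLY
(seat `bsd-jet-pv-2`, session g4; `--supports stmt-BirchSwinnertonDyer-14418`, helper); 0 classes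
move. WHAT THIS IS. The H63 line (`JET.tamagawaExponent_le_mInfty_of_localInputs`, p508802) and
pv-1's duality packages take a Weil pairing datum `e` on `E[n](K̄)` for `E = W⁄K`, `W/ℚ`, `K` a
number field, with SEVEN properties: values in `μₙ`, biadditive, `Γ_K`-equivariant, alternating,
non-degenerate (Silverman III.8.1 (a)–(d) over `K` — the tree CONSTRUCTS such a pairing,
`WeierstrassCurve.exists_weilPairing_holds`, `WeilPairingProofs`) AND `hτe`: equivariance under the
chosen lift `liftAut τ` of an automorphism `τ ∈ Aut(K/ℚ)` (complex conjugation) to `K̄` — which is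
Silverman III.8.1 (d) over `ℚ`, not over `K`. This file PROVES the existence of such a datum
(`exists_weilDatum_liftAut`): transport the tree's Weil pairing of `W/ℚ` on `E(ℚ̄)[n]` along the
tree's `ℚ̄ ≃ₐ[ℚ] K̄` (`absClosureEquiv ℚ K`, `RatClosure.torsionEquiv`; `ZpExtensionProofs`,
`HeegnerPointsKolyvaginConjugation`); `Γ_K` acts through the embedded `Γ_K ≤ Γ_ℚ`
(`RatClosure.torsionEquiv_smul`, `absGaloisRestrict_apply_smul`) and `liftAut τ` acts as the
transport of SOME `γ ∈ Γ_ℚ` (`absGaloisTransport` is onto `Aut_ℚ(K̄)`;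
`RatClosure.torsionEquiv_smul_of_lift`), so BOTH equivariances are the `Γ_ℚ`-equivariance
`weilPairingFun_smul` of the pairing over `ℚ`. Consequence: the Weil-datum binders of the road-K
files are dischargeable by `obtain ⟨e, hμ, hadd₁, hadd₂, hgal, halt, hnondeg, hτe⟩ :=
exists_weilDatum_liftAut W τ (p ^ k) …`. References: [cite: SilvermanAEC2009, Prop. III.8.1 (a)–(d)]
[cite: GrossLMS1991, §3 (τ lifts to an involution), §5 (5.1)].
-/

set_option autoImplicit false

noncomputable section

open scoped Classical

open WeierstrassCurve Field Literature.NumberTheory.EllipticCurves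
  Literature.NumberTheory.GaloisRepresentations

namespace Summit.BirchSwinnertonDyer.Rank1Residual.JET

/-- **A `τ`-equivariant Weil datum on `E[n]/K` for `W/ℚ`** (`n ≥ 2`, `K` a number field,
`τ ∈ Aut(K/ℚ)`): there is `e : E[n](K̄) × E[n](K̄) → K̄` with values in `μₙ`, biadditive,
`Γ_K`-equivariant, alternating, non-degenerate, and equivariant under the chosen lift `liftAut τ`
(acting on `E[n](K̄)` by `(isLiftOfAut_liftAut τ).torsionMap`). Transport of the tree's Weil pairing
of `W/ℚ` along `ℚ̄ ≃ₐ[ℚ] K̄`; both equivariances are Silverman III.8.1 (d) over `ℚ`.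
[cite: SilvermanAEC2009, Prop. III.8.1 (a)–(d)] [cite: GrossLMS1991, §5 (5.1)] -/
theorem exists_weilDatum_liftAut {K : Type} [Field K] [NumberField K] (W : WeierstrassCurve ℚ)
    [W.IsElliptic] (τ : K ≃ₐ[ℚ] K) (n : ℕ) (hn : 2 ≤ n) :
    ∃ e : geomTorsion (W.baseChange K) (n : ℤ) → geomTorsion (W.baseChange K) (n : ℤ) →
        AlgebraicClosure K,
      (∀ S T, e S T ^ n = 1) ∧
      (∀ S₁ S₂ T, e (S₁ + S₂) T = e S₁ T * e S₂ T) ∧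
      (∀ S T₁ T₂, e S (T₁ + T₂) = e S T₁ * e S T₂) ∧
      (∀ (g : absoluteGaloisGroup K) (S T : geomTorsion (W.baseChange K) (n : ℤ)),
        g • e S T = e (g • S) (g • T)) ∧
      (∀ T, e T T = 1) ∧
      (∀ T, (∀ S, e S T = 1) → T = 0) ∧
      ∀ S T, liftAut τ (e S T) =
        e ((isLiftOfAut_liftAut τ).torsionMap W (n : ℤ) S)
          ((isLiftOfAut_liftAut τ).torsionMap W (n : ℤ) T) := by
  -- the Weil pairing of `W/ℚ` on `E(ℚ̄)[n]`
  have hn0 : (n : ℚ) ≠ 0 := by exact_mod_cast (by omega : n ≠ 0)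
  obtain ⟨e₀, hμ₀, hadd₁₀, hadd₂₀, halt₀, hnd₀, hgal₀⟩ := exists_weilPairing_holds W n hn hn0
  -- the transports `θ : E(ℚ̄)[n] ≃ E(K̄)[n]`, `ψ : ℚ̄ ≃ₐ[ℚ] K̄`
  set θ : geomTorsion W (n : ℤ) ≃+ geomTorsion (W.baseChange K) (n : ℤ) :=
    RatClosure.torsionEquiv (K := K) W (n : ℤ) with hθdef
  set ψ : AlgebraicClosure ℚ ≃ₐ[ℚ] AlgebraicClosure K := absClosureEquiv ℚ K with hψdef
  have hψ : ∀ x, ψ x = absClosureEmbedding ℚ K x := fun _ ↦ rfl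
  -- `θ⁻¹` is equivariant along the embedded `Γ_K`
  have hθg : ∀ (g : absoluteGaloisGroup K) (S : geomTorsion (W.baseChange K) (n : ℤ)),
      θ.symm (g • S) = absGaloisRestrict ℚ K g • θ.symm S := fun g S ↦ by
    rw [AddEquiv.symm_apply_eq, hθdef, RatClosure.torsionEquiv_smul, AddEquiv.apply_symm_apply]
  -- the chosen lift of `τ` is the transport of some `γ ∈ Γ_ℚ`
  have hτ : IsLiftOfAut τ (liftAut τ) := isLiftOfAut_liftAut τ
  obtain ⟨γ, hγ'⟩ : ∃ γ : absoluteGaloisGroup ℚ,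
      absGaloisTransport (K := ℚ) (L := K) γ = hτ.algEquiv :=
    (absGaloisTransport (K := ℚ) (L := K)).surjective _
  have hγ : ∀ x, liftAut τ x = absGaloisTransport (K := ℚ) (L := K) γ x := fun x ↦ by
    rw [hγ']
    rfl
  -- `θ⁻¹` intertwines the lift of `τ` with `γ`
  have hθτ : ∀ S : geomTorsion (W.baseChange K) (n : ℤ),
      θ.symm (hτ.torsionMap W (n : ℤ) S) = γ • θ.symm S := fun S ↦ by
    rw [AddEquiv.symm_apply_eq, hθdef, RatClosure.torsionEquiv_smul_of_lift W hτ γ hγ,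
      AddEquiv.apply_symm_apply]
  -- `ψ` is equivariant along the embedded `Γ_K` and along `γ ↦ liftAut τ`
  have hψg : ∀ (g : absoluteGaloisGroup K) (x : AlgebraicClosure ℚ),
      g • ψ x = ψ (absGaloisRestrict ℚ K g • x) := fun g x ↦ by
    rw [hψ, hψ, absGaloisRestrict_apply_smul]
  have hψτ : ∀ x : AlgebraicClosure ℚ, liftAut τ (ψ x) = ψ (γ • x) := fun x ↦ by
    rw [hγ, hψ, hψ, absGaloisTransport_absClosureEmbedding]
  refine ⟨fun S T ↦ ψ (e₀ (θ.symm S) (θ.symm T)), fun S T ↦ ?_, fun S₁ S₂ T ↦ ?_,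
    fun S T₁ T₂ ↦ ?_, fun g S T ↦ ?_, fun T ↦ ?_, fun T hT ↦ ?_, fun S T ↦ ?_⟩
  · show ψ (e₀ (θ.symm S) (θ.symm T)) ^ n = 1
    rw [← map_pow, hμ₀, map_one]
  · show ψ (e₀ (θ.symm (S₁ + S₂)) (θ.symm T)) = ψ (e₀ (θ.symm S₁) (θ.symm T)) * ψ (e₀ (θ.symm S₂) (θ.symm T))
    rw [map_add, hadd₁₀, map_mul]
  · show ψ (e₀ (θ.symm S) (θ.symm (T₁ + T₂))) = ψ (e₀ (θ.symm S) (θ.symm T₁)) * ψ (e₀ (θ.symm S) (θ.symm T₂))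
    rw [map_add, hadd₂₀, map_mul]
  · show g • ψ (e₀ (θ.symm S) (θ.symm T)) = ψ (e₀ (θ.symm (g • S)) (θ.symm (g • T)))
    rw [hψg, hgal₀, hθg, hθg]
  · show ψ (e₀ (θ.symm T) (θ.symm T)) = 1
    rw [halt₀, map_one]
  · have h0 : θ.symm T = 0 := hnd₀ _ fun S' ↦ by
      have h : ψ (e₀ (θ.symm (θ S')) (θ.symm T)) = 1 := hT (θ S')
      rw [AddEquiv.symm_apply_apply] at h
      exact ψ.injective (h.trans (map_one ψ).symm)
    rw [AddEquiv.symm_apply_eq, map_zero] at h0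
    exact h0
  · show liftAut τ (ψ (e₀ (θ.symm S) (θ.symm T))) =
      ψ (e₀ (θ.symm (hτ.torsionMap W (n : ℤ) S)) (θ.symm (hτ.torsionMap W (n : ℤ) T)))
    rw [hψτ, hgal₀, hθτ, hθτ]

end Summit.BirchSwinnertonDyer.Rank1Residual.JET

end
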